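import Summits.QuantumFields.BalabanUV.T4Continuum.Support.NE7FlatKernelRowModulus
import Summits.QuantumFields.BalabanUV.T4Continuum.Support.NE7FlatInteriorGradientDivForm
import HarnessLib

/-!
# NE7FlatInteriorGradientModulus — THE INTERIOR LOG-LIPSCHITZ MODULUS OF THE GRADIENT FOR THE LATTICE POISSON EQUATION: `|Δu| ≤ A`, `|u| ≤ S` on `cube x (7m)` ⟹
# `|∇_μu(z) − ∇_μu(z′)| ≤ C·(A + S∕m²)·h·(1 + log⁺(3m∕h))` for `z, z′ ∈ cube x (m−1)`, `h = |z − z′|_∞` — hence `C^{1,β}` for EVERY `β < 1` with the scaling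
# `(A + S∕m²)·m^{1−β}·h^β`, UNIFORMLY IN `m` (file F2 of gen 112's line «flat interior C^{1,log-Lip} potential theory + (10) ⟹ (9)_{β<1}»)

Cell `pub-balaban`, rung (B)+1 sub-cell t4, lineage `b2b-balaban-t4-ne7-p1` (CRUX PROVER NE7 #1 = OWNER of BINDER row NE7), generation 112.  Memo
`t4/b2b-balaban-t4-ne7-p1-g112/ROAD-G112.md`.  Over pv23's `Beta/PoissonInterior` (`interior_estimate`, the C¹ spline `cutoff`, `lap_mul`, `green_rep`), NE7b g155's
`NE7FlatInteriorGradientDivForm.sum_abs_le_card_mul` and F1 `NE7FlatKernelRowModulus.compact_gradient_modulus`.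
WHY (row NE7, [Balaban1985Variational] Thm 1 (9)∕(10)).  Gen 110∕111 established (kit j342950; ✓ p815039) that the SECOND differences of a constrained minimiser's potential
carry the junction logarithm `(1+k)` at scale `M = L^k`, so that `C^{1,1}` is out of reach, while print's (9) asks for the `β`-Hölder modulus of `∇A` over the physical unit
box.  THIS FILE is the potential-theoretic fact that separates the two: a bounded LAPLACIAN (print's (10), log-free) and a bounded potential force a LOG-LIPSCHITZ gradient,
`h·log(m∕h)`, which is `≤ C_β·m^{1−β}·h^β` for every `β < 1` uniformly in `m` — the Hölder clause of (9) below `β = 1` is a COROLLARY of (10) and the first clause of (9), with no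
logarithm; only `β = 1` sees the junction logarithm.  No third differences of the lattice Green function are needed (the tree stops at second differences): the cutoff's
cross terms are charged through the interior gradient bound, which costs `S∕m²` exactly at the scale of `A`.
THE MECHANISM ([folklore]).  (1) pv23's `interior_estimate` at every centre `y ∈ cube x (3m+1)` (radius `m`, inside `cube x (7m)`): `|∇u(y)| ≤ C_I·(m·A + 7^d·S∕m)`.  (2) The
cut-off function `ũ = χ·u`, `χ = cutoff m x` (`= 1` on `cube x m`, `= 0` off `cube x (3m−1)`, `|∇χ| ≤ 4∕m`, `|∇⁺∇⁻χ| ≤ 4∕m²`): by `lap_mul` rearranged,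
`Δũ = χΔu + Σ_i[∇⁺_iχ·∇⁺_iu + ∇⁻_iχ·∇⁻_iu] + u·Σ_i ∇⁺_i∇⁻_iχ`, so `|Δũ| ≤ A + 8d·C_I(mA + 7^dS∕m)∕m + 4d·S∕m² ≤ K·(A + S∕m²)` on `cube x (3m)`.  (3) F1's
`compact_gradient_modulus` for `ũ` (vanishing off `cube x (3m−1)`): `|∇_μũ(z) − ∇_μũ(z′)| ≤ C_K·K(A + S∕m²)·h·(1 + log⁺(3m∕h))` for `|z′ − x|_∞ ≤ 6m`.  (4) On `cube x (m−1)`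
the cut-off increments are those of `u` (`cutoff_shift_eq_one`).  (5) `h·(1 + log⁺(P∕h)) ≤ (1 + (1−β)⁻¹)·P^{1−β}·h^β` for `0 < h ≤ P` (`Real.log_le_rpow_div`).
WHAT ([folklore]; 0 def, 0 sorry; every `d ≥ 3`; constants existential in `d`).  **`interior_gradient_sup`** (step 1), `lap_cutoff_mul_le` (step 2),
**`interior_gradient_modulus`** (steps 3–4), `mul_one_add_posLog_le_rpow` (step 5), **`interior_gradient_holder`** (`∀ β ∈ [0,1)`:
`≤ C·(1 + (1−β)⁻¹)·(A + S∕m²)·(3m)^{1−β}·h^β`).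
HONEST FRAMING (page 1): flat `ℤ^d` potential theory; nothing of Bałaban's asserted; nothing about minimisers (no log-free Laplacian bound in a physical-box gauge is in the
tree for them — that is the Landau-gauge crux recorded in ROAD-G112); NOT NE3∕NE7 as spine nodes; spine 0∕9; finite T⁴ rung (B)+1 — NOT infinite volume, NOT mass gap, NOT
BetaPertH, NOT Clay (continuum YM on T⁴ ⇐ BetaPertH ∧ nine spine estimates).
-/

set_option autoImplicit false

open scoped BigOperators
open Finset

namespace Summit.QuantumFields.BalabanUV.T4Continuum.NE7FlatInteriorGradientModulus

open Literature.MathematicalPhysics.QuantumFieldTheory.Balaban1983to89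
open B7Prop1Explicit (Site e)
open Literature.Probability.LatticeModels (latticeLaplacianZd)
open Beta.PoissonInterior (cube mem_cube cube_mono mem_cube_zero_iff mem_cube_iff_supNorm supNorm supNorm_le_iff natAbs_le_supNorm
  supNorm_eq_zero_iff supNorm_add_le supNorm_neg supNorm_single_one nrm nrm_pos interior_estimate cutoff cutoff_eq_zero_of_not_mem
  abs_cutoff_le_one cutoff_diff_le cutoff_diff2_le cutoff_shift_eq_one add_mem_cube_succ sub_mem_cube_succ lap_mul)
open NE7FlatInteriorGradientDivForm (sum_abs_le_card_mul)
open NE7FlatKernelRowModulus (compact_gradient_modulus)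

noncomputable section

variable {d : ℕ}

/-! ## §1 The interior gradient bound in sup form, at every centre of the inner cube -/

/-- Cubes nest: `y ∈ cube x R₁` ⟹ `cube y R₂ ⊆ cube x (R₁ + R₂)`. [folklore] -/
theorem cube_subset_cube {x y : Site d} {R₁ R₂ : ℕ} (hy : y ∈ cube x R₁) : cube y R₂ ⊆ cube x (R₁ + R₂) := by
  intro z hz
  rw [mem_cube] at hy hz ⊢
  intro i
  have h1 := hy i
  have h2 := hz i
  have := abs_add_le (z i - y i) (y i - x i)
  rw [show z i - y i + (y i - x i) = z i - x i by ring] at this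
  push_cast
  linarith

/-- **INTERIOR GRADIENT BOUND, SUP FORM** (`d ≥ 3`): `∃ C ≥ 0` such that for `m ≥ 1`, if `|Δu| ≤ A` and `|u| ≤ S` on `cube x (7m)` then
`|u(y + e_j) − u(y)| ≤ C·(m·A + S∕m)` at every `y ∈ cube x (3m+1)` (pv23's `interior_estimate` at the centre `y` with radius `m`, the `ℓ¹` size of `u` on
`cube y (3m) ⊆ cube x (7m)` being `≤ 7^d m^d S`). [folklore] -/
theorem interior_gradient_sup (hd : 3 ≤ d) : ∃ C : ℝ, 0 ≤ C ∧ ∀ (m : ℕ), 1 ≤ m →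
    ∀ (u : Site d → ℝ) (x : Site d) (A S : ℝ),
    (∀ y ∈ cube x (7 * m), |latticeLaplacianZd u y| ≤ A) → (∀ y ∈ cube x (7 * m), |u y| ≤ S) →
    ∀ y ∈ cube x (3 * m + 1), ∀ j : Fin d, |u (y + e j) - u y| ≤ C * ((m : ℝ) * A + S / m) := by
  obtain ⟨C, hC, hI⟩ := interior_estimate hd
  refine ⟨C * 7 ^ d, by positivity, fun m hm u x A S hA hS y hy j => ?_⟩
  have hm0 : (0 : ℝ) < m := by exact_mod_cast hm
  have hsub : cube y (3 * m) ⊆ cube x (7 * m) := by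
    refine (cube_subset_cube hy).trans (cube_mono ?_)
    omega
  have hA' : ∀ z ∈ cube y (3 * m), |latticeLaplacianZd u z| ≤ A := fun z hz => hA z (hsub hz)
  have hS' : ∀ z ∈ cube y (3 * m), |u z| ≤ S := fun z hz => hS z (hsub hz)
  have hB := sum_abs_le_card_mul hm u y hS'
  have h := (hI m hm u y A _ hA' hB).2 j
  have hA0 : 0 ≤ A := (abs_nonneg _).trans (hA' y (by rw [mem_cube]; intro i; simp))
  have hS0 : 0 ≤ S := (abs_nonneg _).trans (hS' y (by rw [mem_cube]; intro i; simp))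
  have e1 : (7 : ℝ) ^ d * (m : ℝ) ^ d * S / (m : ℝ) ^ (d + 1) = 7 ^ d * (S / m) := by
    rw [pow_succ]
    field_simp
  calc |u (y + e j) - u y| ≤ C * ((m : ℝ) * A + 7 ^ d * (m : ℝ) ^ d * S / (m : ℝ) ^ (d + 1)) := h
    _ = C * ((m : ℝ) * A) + C * 7 ^ d * (S / m) := by rw [e1]; ring
    _ ≤ C * 7 ^ d * ((m : ℝ) * A) + C * 7 ^ d * (S / m) := by
        have : C * ((m : ℝ) * A) ≤ C * 7 ^ d * ((m : ℝ) * A) := by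
          have h7 : (1 : ℝ) ≤ 7 ^ d := one_le_pow₀ (by norm_num)
          nlinarith [mul_nonneg hC (mul_nonneg hm0.le hA0)]
        linarith
    _ = C * 7 ^ d * ((m : ℝ) * A + S / m) := by ring

/-! ## §2 The Laplacian of the cut-off function -/

/-- **THE LAPLACIAN OF `χ·u`**: if `|Δu(y)| ≤ A`, `|u(y)| ≤ S`, and the first differences of `u` at `y` and at the `y − e_i` are `≤ D`, then for pv23's cutoff
`χ = cutoff m x` (`|χ| ≤ 1`, `|∇χ| ≤ 4∕m`, `|∇⁺∇⁻χ| ≤ 4∕m²`): `|Δ(χu)(y)| ≤ A + 8d·D∕m + 4d·S∕m²` (`lap_mul` rearranged as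
`χΔu + Σ_i[∇⁺_iχ·∇⁺_iu + ∇⁻_iχ·∇⁻_iu] + u·Σ_i∇⁺_i∇⁻_iχ`). [folklore] -/
theorem lap_cutoff_mul_le {m : ℕ} (hm : 1 ≤ m) (u : Site d → ℝ) (x y : Site d) {A S D : ℝ}
    (hA : |latticeLaplacianZd u y| ≤ A) (hS : |u y| ≤ S)
    (hDp : ∀ i : Fin d, |u (y + Pi.single i 1) - u y| ≤ D) (hDm : ∀ i : Fin d, |u (y - Pi.single i 1) - u y| ≤ D) :
    |latticeLaplacianZd (fun z => cutoff m x z * u z) y| ≤ A + 8 * d * D / m + 4 * d * S / (m : ℝ) ^ 2 := by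
  have hm0 : (0 : ℝ) < m := by exact_mod_cast hm
  rw [lap_mul]
  have hχ : |cutoff m x y| ≤ 1 := abs_cutoff_le_one hm x y
  have h1 : |cutoff m x y * latticeLaplacianZd u y| ≤ A := by
    rw [abs_mul]
    calc |cutoff m x y| * |latticeLaplacianZd u y| ≤ 1 * A := mul_le_mul hχ hA (abs_nonneg _) zero_le_one
      _ = A := one_mul A
  have hterm : ∀ i : Fin d,
      |(cutoff m x (y + Pi.single i 1) - cutoff m x y) * u (y + Pi.single i 1) +
        (cutoff m x (y - Pi.single i 1) - cutoff m x y) * u (y - Pi.single i 1)| ≤ 8 * D / m + 4 * S / (m : ℝ) ^ 2 := by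
    intro i
    have e : (cutoff m x (y + Pi.single i 1) - cutoff m x y) * u (y + Pi.single i 1) +
        (cutoff m x (y - Pi.single i 1) - cutoff m x y) * u (y - Pi.single i 1)
        = (cutoff m x (y + Pi.single i 1) - cutoff m x y) * (u (y + Pi.single i 1) - u y) +
          (cutoff m x (y - Pi.single i 1) - cutoff m x y) * (u (y - Pi.single i 1) - u y) +
          (cutoff m x (y + Pi.single i 1) - 2 * cutoff m x y + cutoff m x (y - Pi.single i 1)) * u y := by ring
    rw [e]
    obtain ⟨hc1, hc2⟩ := cutoff_diff_le hm x y i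
    have hc3 := cutoff_diff2_le hm x y i
    have t1 : |(cutoff m x (y + Pi.single i 1) - cutoff m x y) * (u (y + Pi.single i 1) - u y)| ≤ 4 / m * D := by
      rw [abs_mul]; exact mul_le_mul hc1 (hDp i) (abs_nonneg _) (by positivity)
    have t2 : |(cutoff m x (y - Pi.single i 1) - cutoff m x y) * (u (y - Pi.single i 1) - u y)| ≤ 4 / m * D := by
      rw [abs_mul]; exact mul_le_mul hc2 (hDm i) (abs_nonneg _) (by positivity)
    have t3 : |(cutoff m x (y + Pi.single i 1) - 2 * cutoff m x y + cutoff m x (y - Pi.single i 1)) * u y| ≤ 4 / (m : ℝ) ^ 2 * S := by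
      rw [abs_mul]; exact mul_le_mul hc3 hS (abs_nonneg _) (by positivity)
    calc _ ≤ |(cutoff m x (y + Pi.single i 1) - cutoff m x y) * (u (y + Pi.single i 1) - u y) +
          (cutoff m x (y - Pi.single i 1) - cutoff m x y) * (u (y - Pi.single i 1) - u y)| +
          |(cutoff m x (y + Pi.single i 1) - 2 * cutoff m x y + cutoff m x (y - Pi.single i 1)) * u y| := abs_add_le _ _
      _ ≤ (|(cutoff m x (y + Pi.single i 1) - cutoff m x y) * (u (y + Pi.single i 1) - u y)| +
          |(cutoff m x (y - Pi.single i 1) - cutoff m x y) * (u (y - Pi.single i 1) - u y)|) +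
          |(cutoff m x (y + Pi.single i 1) - 2 * cutoff m x y + cutoff m x (y - Pi.single i 1)) * u y| := by
          gcongr; exact abs_add_le _ _
      _ ≤ (4 / m * D + 4 / m * D) + 4 / (m : ℝ) ^ 2 * S := by gcongr
      _ = 8 * D / m + 4 * S / (m : ℝ) ^ 2 := by ring
  have h2 : |∑ i : Fin d, ((cutoff m x (y + Pi.single i 1) - cutoff m x y) * u (y + Pi.single i 1) +
        (cutoff m x (y - Pi.single i 1) - cutoff m x y) * u (y - Pi.single i 1))| ≤ d * (8 * D / m + 4 * S / (m : ℝ) ^ 2) := by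
    calc _ ≤ ∑ i : Fin d, |(cutoff m x (y + Pi.single i 1) - cutoff m x y) * u (y + Pi.single i 1) +
          (cutoff m x (y - Pi.single i 1) - cutoff m x y) * u (y - Pi.single i 1)| := Finset.abs_sum_le_sum_abs _ _
      _ ≤ ∑ _i : Fin d, (8 * D / m + 4 * S / (m : ℝ) ^ 2) := Finset.sum_le_sum fun i _ => hterm i
      _ = d * (8 * D / m + 4 * S / (m : ℝ) ^ 2) := by
          rw [Finset.sum_const, Finset.card_univ, Fintype.card_fin, nsmul_eq_mul]
  calc _ ≤ |cutoff m x y * latticeLaplacianZd u y| + |∑ i : Fin d, ((cutoff m x (y + Pi.single i 1) - cutoff m x y) * u (y + Pi.single i 1) +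
        (cutoff m x (y - Pi.single i 1) - cutoff m x y) * u (y - Pi.single i 1))| := abs_add_le _ _
    _ ≤ A + d * (8 * D / m + 4 * S / (m : ℝ) ^ 2) := add_le_add h1 h2
    _ = A + 8 * d * D / m + 4 * d * S / (m : ℝ) ^ 2 := by ring

/-! ## §3 The interior log-Lipschitz modulus of the gradient -/

/-- **THE INTERIOR LOG-LIPSCHITZ MODULUS OF THE GRADIENT** (`d ≥ 3`): `∃ C ≥ 0` (a function of `d`) such that for every `m ≥ 1`, every lattice function `u`, every centre
`x` and all `A, S` with `|Δu| ≤ A` and `|u| ≤ S` on `cube x (7m)`: for all `z, z′ ∈ cube x (m−1)` and every direction `μ` (`h := |z − z′|_∞`),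
`|(u(z + e_μ) − u(z)) − (u(z′ + e_μ) − u(z′))| ≤ C·(A + S∕m²)·h·(1 + log⁺(3m∕h))`. [folklore] -/
theorem interior_gradient_modulus (hd : 3 ≤ d) : ∃ C : ℝ, 0 ≤ C ∧ ∀ (m : ℕ), 1 ≤ m →
    ∀ (u : Site d → ℝ) (x : Site d) (A S : ℝ),
    (∀ y ∈ cube x (7 * m), |latticeLaplacianZd u y| ≤ A) → (∀ y ∈ cube x (7 * m), |u y| ≤ S) →
    ∀ (z z' : Site d), z ∈ cube x (m - 1) → z' ∈ cube x (m - 1) → ∀ μ : Fin d,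
      |(u (z + e μ) - u z) - (u (z' + e μ) - u z')|
        ≤ C * (A + S / (m : ℝ) ^ 2) * (supNorm (z - z') : ℝ) * (1 + Real.posLog ((3 * m : ℝ) / supNorm (z - z'))) := by
  obtain ⟨C_I, hC_I, hgrad⟩ := interior_gradient_sup hd
  obtain ⟨C_K, hC_K, hmod⟩ := compact_gradient_modulus hd
  -- `A′ ≤ K·(A + S/m²)` with `K = 1 + 8d·C_I·(1 + 7^d)·1 + 4d` (using `m ≥ 1` where needed)
  set K : ℝ := 1 + 8 * d * C_I + (8 * d * C_I + 4 * d) with hKdef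
  have hK0 : 0 ≤ K := by positivity
  refine ⟨C_K * K, by positivity, fun m hm u x A S hA hS z z' hz hz' μ => ?_⟩
  have hm0 : (0 : ℝ) < m := by exact_mod_cast hm
  have hd0 : 0 < d := by omega
  have hA0 : 0 ≤ A := (abs_nonneg _).trans (hA x (by rw [mem_cube]; intro i; simp))
  have hS0 : 0 ≤ S := (abs_nonneg _).trans (hS x (by rw [mem_cube]; intro i; simp))
  -- step 1: first differences on `cube x (3m+1)`
  set D : ℝ := C_I * ((m : ℝ) * A + S / m) with hDdef
  have hD : ∀ y ∈ cube x (3 * m + 1), ∀ j : Fin d, |u (y + e j) - u y| ≤ D := hgrad m hm u x A S hA hS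
  -- step 2: the Laplacian of the cut-off function on `cube x (3m)`
  set A' : ℝ := A + 8 * d * D / m + 4 * d * S / (m : ℝ) ^ 2 with hA'def
  have hlap : ∀ y ∈ cube x (3 * m - 1 + 1), |latticeLaplacianZd (fun w => cutoff m x w * u w) y| ≤ A' := by
    intro y hy
    have h3m : 3 * m - 1 + 1 = 3 * m := by omega
    rw [h3m] at hy
    have hy7 : y ∈ cube x (7 * m) := cube_mono (by omega) hy
    have hy31 : y ∈ cube x (3 * m + 1) := cube_mono (by omega) hy
    refine lap_cutoff_mul_le hm u x y (hA y hy7) (hS y hy7) (fun i => hD y hy31 i) (fun i => ?_)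
    have hy' : y - Pi.single i 1 ∈ cube x (3 * m + 1) := sub_mem_cube_succ hy (supNorm_single_one i)
    have := hD (y - Pi.single i 1) hy' i
    rw [show y - Pi.single i 1 + e i = y from sub_add_cancel y _] at this
    rwa [abs_sub_comm] at this
  -- step 3: F1's compact modulus for `χu` (vanishing off `cube x (3m−1)`)
  have hvan : ∀ y, y ∉ cube x (3 * m - 1) → (fun w => cutoff m x w * u w) y = 0 := by
    intro y hy
    show cutoff m x y * u y = 0
    rw [cutoff_eq_zero_of_not_mem hm hy, zero_mul]
  have hz'x : supNorm (z' - x) ≤ 2 * (3 * m - 1) + 2 := by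
    have := (mem_cube_iff_supNorm).1 hz'
    omega
  have key := hmod x (3 * m - 1) _ hvan A' hlap z z' μ hz'x
  have hR : (((3 * m - 1 : ℕ) : ℝ) + 1) = 3 * m := by
    have : (3 * m - 1 : ℕ) + 1 = 3 * m := by omega
    exact_mod_cast this
  rw [hR] at key
  -- step 4: on `cube x (m−1)` the cut-off increments are those of `u`
  have hone : ∀ w ∈ cube x (m - 1), cutoff m x w = 1 ∧ cutoff m x (w + e μ) = 1 := by
    intro w hw
    rw [mem_cube] at hw
    have hw' : ∀ j, |w j - x j| + 1 ≤ (m : ℤ) := fun j => by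
      have := hw j
      have : ((m - 1 : ℕ) : ℤ) = m - 1 := by omega
      omega
    have h := cutoff_shift_eq_one hw' μ
    exact ⟨h.1, h.2.1⟩
  obtain ⟨hz1, hz2⟩ := hone z hz
  obtain ⟨hz'1, hz'2⟩ := hone z' hz'
  have hlhs : (fun w => cutoff m x w * u w) (z + e μ) - (fun w => cutoff m x w * u w) z
      - ((fun w => cutoff m x w * u w) (z' + e μ) - (fun w => cutoff m x w * u w) z')
      = (u (z + e μ) - u z) - (u (z' + e μ) - u z') := by
    simp only [hz1, hz2, hz'1, hz'2, one_mul]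
  rw [hlhs] at key
  -- the constant: `A′ ≤ K·(A + S/m²)`
  have hA'le : A' ≤ K * (A + S / (m : ℝ) ^ 2) := by
    have e1 : 8 * d * D / m = 8 * d * C_I * A + 8 * d * C_I * (S / (m : ℝ) ^ 2) := by
      rw [hDdef]; field_simp
    have e2 : 4 * d * S / (m : ℝ) ^ 2 = 4 * d * (S / (m : ℝ) ^ 2) := by ring
    rw [hA'def, e1, e2, hKdef]
    set q : ℝ := S / (m : ℝ) ^ 2 with hqdef
    have hq : 0 ≤ q := by positivity
    have hdr : (0 : ℝ) ≤ d := by positivity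
    have t1 : 0 ≤ (d : ℝ) * C_I * A := mul_nonneg (mul_nonneg hdr hC_I) hA0
    have t2 : 0 ≤ (d : ℝ) * C_I * q := mul_nonneg (mul_nonneg hdr hC_I) hq
    have t3 : 0 ≤ (d : ℝ) * A := mul_nonneg hdr hA0
    have t4 : 0 ≤ (d : ℝ) * q := mul_nonneg hdr hq
    nlinarith [t1, t2, t3, t4, hq, hA0]
  have hP0 : 0 ≤ Real.posLog ((3 * m : ℝ) / supNorm (z - z')) := Real.posLog_nonneg
  calc |(u (z + e μ) - u z) - (u (z' + e μ) - u z')|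
      ≤ C_K * A' * (supNorm (z - z') : ℝ) * (1 + Real.posLog ((3 * m : ℝ) / supNorm (z - z'))) := key
    _ ≤ C_K * (K * (A + S / (m : ℝ) ^ 2)) * (supNorm (z - z') : ℝ) * (1 + Real.posLog ((3 * m : ℝ) / supNorm (z - z'))) := by
        gcongr
    _ = _ := by ring

/-! ## §4 The Hölder form: every `β < 1`, uniformly in `m` -/

/-- **`h·(1 + log⁺(P∕h)) ≤ (1 + (1−β)⁻¹)·P^{1−β}·h^β`** for `0 < h ≤ P` and `β < 1` (`log t ≤ t^{1−β}∕(1−β)`, `Real.log_le_rpow_div`, at `t = P∕h ≥ 1`). [folklore] -/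
theorem mul_one_add_posLog_le_rpow {P h β : ℝ} (hh : 0 < h) (hhP : h ≤ P) (hβ : β < 1) :
    h * (1 + Real.posLog (P / h)) ≤ (1 + (1 - β)⁻¹) * P ^ (1 - β) * h ^ β := by
  have hP : 0 < P := lt_of_lt_of_le hh hhP
  have ht1 : 1 ≤ P / h := by rw [le_div_iff₀ hh, one_mul]; exact hhP
  have ht0 : 0 < P / h := by positivity
  have hε : 0 < 1 - β := by linarith
  rw [Real.posLog_eq_log (by rw [abs_of_pos ht0]; exact ht1)]
  have hlog : Real.log (P / h) ≤ (P / h) ^ (1 - β) / (1 - β) := Real.log_le_rpow_div ht0.le hε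
  have hone : (1 : ℝ) ≤ (P / h) ^ (1 - β) := Real.one_le_rpow ht1 hε.le
  have hsum : 1 + Real.log (P / h) ≤ (1 + (1 - β)⁻¹) * (P / h) ^ (1 - β) := by
    rw [add_mul, one_mul, inv_mul_eq_div]
    linarith
  have hsplit : h * (P / h) ^ (1 - β) = P ^ (1 - β) * h ^ β := by
    rw [Real.div_rpow hP.le hh.le, Real.rpow_sub hh, Real.rpow_one]
    field_simp
  calc h * (1 + Real.log (P / h)) ≤ h * ((1 + (1 - β)⁻¹) * (P / h) ^ (1 - β)) := mul_le_mul_of_nonneg_left hsum hh.le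
    _ = (1 + (1 - β)⁻¹) * (h * (P / h) ^ (1 - β)) := by ring
    _ = (1 + (1 - β)⁻¹) * P ^ (1 - β) * h ^ β := by rw [hsplit]; ring

/-- **THE INTERIOR `C^{1,β}` ESTIMATE FOR EVERY `β < 1`, UNIFORMLY IN `m`** (`d ≥ 3`): with the constant `C` of `interior_gradient_modulus`, for `m ≥ 1`, `|Δu| ≤ A` and
`|u| ≤ S` on `cube x (7m)`, `z, z′ ∈ cube x (m−1)`, `0 ≤ β < 1` (`h := |z − z′|_∞`):
`|(u(z + e_μ) − u(z)) − (u(z′ + e_μ) − u(z′))| ≤ C·(1 + (1−β)⁻¹)·(A + S∕m²)·(3m)^{1−β}·h^β` — the modulus `h·log(3m∕h)` of §3 is `≤ C_β·m^{1−β}·h^β`; the constant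
blows up like `(1−β)⁻¹` as `β ↑ 1` and NOTHING is claimed at `β = 1`. [folklore] -/
theorem interior_gradient_holder (hd : 3 ≤ d) : ∃ C : ℝ, 0 ≤ C ∧ ∀ (m : ℕ), 1 ≤ m →
    ∀ (u : Site d → ℝ) (x : Site d) (A S : ℝ),
    (∀ y ∈ cube x (7 * m), |latticeLaplacianZd u y| ≤ A) → (∀ y ∈ cube x (7 * m), |u y| ≤ S) →
    ∀ (β : ℝ), 0 ≤ β → β < 1 →
    ∀ (z z' : Site d), z ∈ cube x (m - 1) → z' ∈ cube x (m - 1) → ∀ μ : Fin d,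
      |(u (z + e μ) - u z) - (u (z' + e μ) - u z')|
        ≤ C * (1 + (1 - β)⁻¹) * (A + S / (m : ℝ) ^ 2) * (3 * m : ℝ) ^ (1 - β) * (supNorm (z - z') : ℝ) ^ β := by
  obtain ⟨C, hC, hmod⟩ := interior_gradient_modulus hd
  refine ⟨C, hC, fun m hm u x A S hA hS β hβ0 hβ1 z z' hz hz' μ => ?_⟩
  have key := hmod m hm u x A S hA hS z z' hz hz' μ
  have hm0 : (0 : ℝ) < m := by exact_mod_cast hm
  have hA0 : 0 ≤ A := (abs_nonneg _).trans (hA x (by rw [mem_cube]; intro i; simp))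
  have hS0 : 0 ≤ S := (abs_nonneg _).trans (hS x (by rw [mem_cube]; intro i; simp))
  have hAS : 0 ≤ A + S / (m : ℝ) ^ 2 := by positivity
  have hε : 0 < 1 - β := by linarith
  rcases Nat.eq_zero_or_pos (supNorm (z - z')) with hh0 | hh1
  · -- `h = 0`: both sides vanish (or the right side is nonnegative)
    have hzz : z = z' := sub_eq_zero.1 (supNorm_eq_zero_iff.1 hh0)
    subst hzz
    simp only [sub_self, abs_zero]
    have : (0 : ℝ) ≤ (supNorm (z - z) : ℝ) ^ β := Real.rpow_nonneg (by positivity) β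
    have h3 : (0 : ℝ) ≤ (3 * m : ℝ) ^ (1 - β) := Real.rpow_nonneg (by positivity) _
    have hb : (0 : ℝ) ≤ 1 + (1 - β)⁻¹ := by positivity
    positivity
  -- `1 ≤ h ≤ 2(m−1) ≤ 3m`
  have hh : (0 : ℝ) < supNorm (z - z') := by exact_mod_cast hh1
  have hhP : (supNorm (z - z') : ℝ) ≤ 3 * m := by
    have h1 : supNorm (z - z') ≤ supNorm (z - x) + supNorm (x - z') := by
      simpa using supNorm_add_le (z - x) (x - z')
    have h2 : supNorm (x - z') = supNorm (z' - x) := by rw [← supNorm_neg, neg_sub]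
    have h3 := (mem_cube_iff_supNorm).1 hz
    have h4 := (mem_cube_iff_supNorm).1 hz'
    have : supNorm (z - z') ≤ 3 * m := by omega
    exact_mod_cast this
  have harith := mul_one_add_posLog_le_rpow hh hhP hβ1
  calc |(u (z + e μ) - u z) - (u (z' + e μ) - u z')|
      ≤ C * (A + S / (m : ℝ) ^ 2) * (supNorm (z - z') : ℝ) * (1 + Real.posLog ((3 * m : ℝ) / supNorm (z - z'))) := key
    _ = C * (A + S / (m : ℝ) ^ 2) * ((supNorm (z - z') : ℝ) * (1 + Real.posLog ((3 * m : ℝ) / supNorm (z - z')))) := by ring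
    _ ≤ C * (A + S / (m : ℝ) ^ 2) * ((1 + (1 - β)⁻¹) * (3 * m : ℝ) ^ (1 - β) * (supNorm (z - z') : ℝ) ^ β) :=
        mul_le_mul_of_nonneg_left harith (by positivity)
    _ = _ := by ring

end

end Summit.QuantumFields.BalabanUV.T4Continuum.NE7FlatInteriorGradientModulus
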